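/-
Copyright: the b2b-balaban T⁴-continuum CRUX team, row NE7b OWNER lineage `t4-ne7b-p1` (gen 106). Project licence.
-/
import Summits.QuantumFields.BalabanUV.T4Continuum.Spine.NE7b.ConvexTiltMoment

/-!
# THE CONVEXITY ROAD IN THE CENTRED EVEN CLASS: the tilted means VANISH, so the (R1″)-class letter of
# `…ConvexTiltMoment.exp_moment_le_of_uniformlyConvex` drops out — `∫e^{−V} ≤ exp(Σ_k q_k‖u_k‖²∕λ)·∫e^{−(V+g)}` for EVEN `V`
# (row NE7b, node U5c; residual (R2′) family (2); kernel corollaries)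

Cell `pub-balaban`, sub-cell `t4`, spine estimate NE7b (`T4WeightBudget.RelWeightBound`; the cell's OWN estimate — NOT PRINTED in
[Bałaban 1983–89], NOT PROVED).  Crux-route work under `Spine/NE7b/` by the row's OWNER; NOTHING of Bałaban's is named or asserted;
no `T4Continuum/Support` leaf typed; no `def`; zero `sorry`.

WHY.  The convexity road (`…ConvexTiltMoment`) bounds the sacrificed exponential moment by `exp(tr(Q)∕λ + mᵀQm)` with `m` the TILTED
mean — a displayed (R1″)-class letter.  In the CENTRED EVEN class (the window symmetric, the exponent even: `V(−x) = V(x)` — the class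
in which leaf-01 g79's Anderson files and the refuter's κ-ne7bref-g67-4 place the zero-cost statements) the tilted measure is symmetric
and every linear functional has tilted mean ZERO, so the bound is `exp(tr(Q)∕λ)` outright: rank-extensive, threshold-free, value-free AND
shift-free.  (With COUPLED fibres the exponent carries the exterior shift `2x₁ᵀS₁₂x₂` and is not even — there the letter `m` is real
and is the induced ∕ tilted mean energy of record.)

WHAT IS PROVED ([folklore]; `integral_neg_eq_self` for Lebesgue measure, `integral_tilted`):
`integral_inner_mul_exp_neg_eq_zero_of_even` (`∫⟪u,x⟫e^{−V x}dx = 0` for even `V`), `tiltedMean_eq_zero_of_even`,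
**`exp_moment_le_of_uniformlyConvex_even`**, **`exp_moment_le_of_uniformlyConvex_window_even`**.

NOT HERE (honest): evenness ∕ convexity of Bałaban's exponents ((A1c) readings); anything of Bałaban's.  NE7b NOT PRINTED ∕ NOT
PROVED; spine PROVED 0∕9; rung (B)+1 on a FINITE torus — NOT infinite volume, NOT the mass gap, NOT Clay.
HONEST DEPENDENCY: continuum YM on T⁴ ⇐ BetaPertH ∧ nine spine estimates (0/9 proved); BetaPertH ⇐ (D1) ∧ (D4) ∧ CAP+tail.
-/

set_option autoImplicit false

noncomputable section

open MeasureTheory Real Finset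
open scoped RealInnerProductSpace
open Summit.QuantumFields.BalabanUV.T4Continuum.NE7b.ConvexTiltMoment

namespace Summit.QuantumFields.BalabanUV.T4Continuum.NE7b.ConvexTiltEven

variable {n : ℕ}

/-- For EVEN `V` the first moments of `e^{−V}` vanish: `∫⟪u, x⟫·e^{−V x} dx = 0` (the integrand is odd; Lebesgue measure is
invariant under `x ↦ −x`). [folklore] -/
theorem integral_inner_mul_exp_neg_eq_zero_of_even {V : EuclideanSpace ℝ (Fin n) → ℝ}
    (hV : ∀ x, V (-x) = V x) (u : EuclideanSpace ℝ (Fin n)) :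
    ∫ x : EuclideanSpace ℝ (Fin n), ⟪u, x⟫ * exp (-V x) = 0 := by
  have h := integral_neg_eq_self (fun x : EuclideanSpace ℝ (Fin n) => ⟪u, x⟫ * exp (-V x)) volume
  simp only [inner_neg_right, hV, neg_mul, integral_neg] at h
  linarith

/-- Hence every linear functional has TILTED mean zero under `ν_V = e^{−V}dx ∕ ∫e^{−V}` for even `V`. [folklore] -/
theorem tiltedMean_eq_zero_of_even {V : EuclideanSpace ℝ (Fin n) → ℝ} (hV : ∀ x, V (-x) = V x)
    (u : EuclideanSpace ℝ (Fin n)) :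
    ∫ x, ⟪u, x⟫ ∂(volume.tilted fun x : EuclideanSpace ℝ (Fin n) => -V x) = 0 := by
  rw [integral_tilted]
  have e : (fun x : EuclideanSpace ℝ (Fin n) =>
      (exp (-V x) / ∫ y : EuclideanSpace ℝ (Fin n), exp (-V y)) • ⟪u, x⟫) =
      fun x => (∫ y : EuclideanSpace ℝ (Fin n), exp (-V y))⁻¹ * (⟪u, x⟫ * exp (-V x)) := by
    funext x; rw [smul_eq_mul]; ring
  rw [e, integral_const_mul, integral_inner_mul_exp_neg_eq_zero_of_even hV u, mul_zero]

/-- **THE CONVEXITY ROAD IN THE CENTRED EVEN CLASS**: for `V` EVEN, continuous, `λ`-uniformly convex (first-order letter), `e^{−V}`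
integrable, and `g = Σ_k q_k⟪u_k,·⟫²` (`q_k ≥ 0`) with displayed tilted integrabilities:
`∫e^{−V} ≤ exp(Σ_k q_k·λ⁻¹‖u_k‖²)·∫e^{−(V+g)}` — the tilted-mean letter of `exp_moment_le_of_uniformlyConvex` vanishes. [folklore] -/
theorem exp_moment_le_of_uniformlyConvex_even {V : EuclideanSpace ℝ (Fin n) → ℝ} {lam : ℝ} {r : ℕ} (hlam : 0 < lam)
    (hVc : Continuous V) (hVe : ∀ x, V (-x) = V x)
    (hV : ∀ x y : EuclideanSpace ℝ (Fin n), V x + ⟪gradient V x, y - x⟫ + lam / 2 * ‖y - x‖ ^ 2 ≤ V y)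
    (hZ : Integrable fun x => exp (-V x)) (q : Fin r → ℝ) (hq : ∀ k, 0 ≤ q k) (u : Fin r → EuclideanSpace ℝ (Fin n))
    (h1 : ∀ k, Integrable (fun x => ⟪u k, x⟫) (volume.tilted fun x => -V x))
    (h2 : ∀ k, Integrable (fun x => ⟪u k, x⟫ ^ 2) (volume.tilted fun x => -V x)) :
    ∫ x, exp (-V x) ≤ exp (∑ k, q k * (lam⁻¹ * ‖u k‖ ^ 2)) * ∫ x, exp (-(V x + ∑ k, q k * ⟪u k, x⟫ ^ 2)) := by
  have h := exp_moment_le_of_uniformlyConvex hlam hVc hV hZ q hq u h1 h2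
  simp_rw [tiltedMean_eq_zero_of_even hVe] at h
  simpa using h

/-- **THE SAME ON A WINDOW** carrying the fraction `1−η` of the tilted mass (`exp_moment_le_of_uniformlyConvex_window` in the even
class): `∫_K e^{−V} ≤ exp((Σ_k q_k·λ⁻¹‖u_k‖²)∕(1−η))·∫_K e^{−(V+g)}`. [folklore] -/
theorem exp_moment_le_of_uniformlyConvex_window_even {V : EuclideanSpace ℝ (Fin n) → ℝ} {lam η : ℝ} {r : ℕ} (hlam : 0 < lam)
    (hVc : Continuous V) (hVe : ∀ x, V (-x) = V x)
    (hV : ∀ x y : EuclideanSpace ℝ (Fin n), V x + ⟪gradient V x, y - x⟫ + lam / 2 * ‖y - x‖ ^ 2 ≤ V y)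
    (hZ : Integrable fun x => exp (-V x)) (q : Fin r → ℝ) (hq : ∀ k, 0 ≤ q k) (u : Fin r → EuclideanSpace ℝ (Fin n))
    (h1 : ∀ k, Integrable (fun x => ⟪u k, x⟫) (volume.tilted fun x => -V x))
    (h2 : ∀ k, Integrable (fun x => ⟪u k, x⟫ ^ 2) (volume.tilted fun x => -V x))
    (K : Set (EuclideanSpace ℝ (Fin n))) (hη : η < 1)
    (hmass : (1 - η) * ∫ x, exp (-V x) ≤ ∫ x in K, exp (-V x)) :
    ∫ x in K, exp (-V x) ≤
      exp ((∑ k, q k * (lam⁻¹ * ‖u k‖ ^ 2)) / (1 - η)) * ∫ x in K, exp (-(V x + ∑ k, q k * ⟪u k, x⟫ ^ 2)) := by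
  have h := exp_moment_le_of_uniformlyConvex_window hlam hVc hV hZ q hq u h1 h2 K hη hmass
  simp_rw [tiltedMean_eq_zero_of_even hVe] at h
  simpa using h

end Summit.QuantumFields.BalabanUV.T4Continuum.NE7b.ConvexTiltEven

end
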